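import Mathlib.Analysis.SpecialFunctions.Log.Deriv
import Mathlib.Analysis.SpecialFunctions.Log.NegMulLog
import Mathlib.Analysis.SpecialFunctions.Pow.Deriv
import Mathlib.Analysis.Calculus.MeanValue
import Mathlib.MeasureTheory.Function.SpecialFunctions.Basic
import HarnessLib

/-!
# Windowed entropy balance — helper A: the floored logarithm and its convex primitive

Helper file for the registered stub `stub_windowedEntropyBalance` of the line `empirical-h-theorem`
(crux `InformationPercolationEngine.ChaosClosesEuler`, stmt-AtomisticToContinuum-15141).

WHAT. The one-dimensional calculus of the coarse-grained entropy density used by the windowed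
entropy balance: the logarithm floored `C¹`-smoothly at a level `y₀ > 0`,
`ℓ(y) = log y` for `y ≥ y₀`, `ℓ(y) = log y₀ + (y − y₀)/y₀` below (`flog`), and its primitive
`𝔰` with `𝔰' = 1 + ℓ`, `𝔰(0) = 0` (`sK`: `y log y + y₀/2` above the floor, the quadratic
`y log y₀ + y²/(2y₀)` below). We prove: `𝔰` is differentiable with derivative `1 + ℓ`
(`hasDerivAt_sK`), `ℓ` is `y₀⁻¹`-Lipschitz (`abs_flog_sub_flog_le`), the first-order Taylor bound
`|𝔰(b) − 𝔰(a) − (1 + ℓ(a))(b − a)| ≤ (b − a)²/y₀` (`abs_sK_sub_sub_le`), the sup bounds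
`|ℓ(y)| ≤ |log y₀| + |log M| + 1`, `|𝔰(y)| ≤ (|log y₀| + |log M| + 2) y` on `[0, M]`, joint
measurability, and the velocity floor `y₀(v) = e^{−K}(1 + ‖v‖²)⁻²` with its logarithmic weight
`A(v) = |K| + |log M| + 2 + 2 log(1 + ‖v‖²) ≤ |K| + |log M| + 2 + 4‖v‖`.

References: L. Boltzmann (1872) (the `H`-functional); folklore.
-/

noncomputable section

namespace Summit.AtomisticToContinuum.HydrodynamicLimit.Theorems.ChaosClosesEulerEntropyBalance

open scoped BigOperators Topology Classical
open Filter Set MeasureTheory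

/-! ## §1 The floored logarithm `ℓ` and its primitive `𝔰` -/

/-- The logarithm floored `C¹`-smoothly at the level `y₀`: `log y` for `y ≥ y₀`, the tangent
continuation `log y₀ + (y − y₀)/y₀` below. [folklore] -/
def flog (y0 y : ℝ) : ℝ := if y0 ≤ y then Real.log y else Real.log y0 + (y - y0) / y0

/-- The convex primitive `𝔰` of `1 + ℓ` with `𝔰(0) = 0`: `y log y + y₀/2` above the floor,
`y log y₀ + y²/(2y₀)` below. [folklore] -/
def sK (y0 y : ℝ) : ℝ := if y0 ≤ y then y * Real.log y + y0 / 2 else y * Real.log y0 + y ^ 2 / (2 * y0)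

/-- `ℓ` above the floor. [folklore] -/
theorem flog_of_le {y0 y : ℝ} (h : y0 ≤ y) : flog y0 y = Real.log y := if_pos h

/-- `ℓ` below the floor. [folklore] -/
theorem flog_of_lt {y0 y : ℝ} (h : y < y0) : flog y0 y = Real.log y0 + (y - y0) / y0 := if_neg (not_le.2 h)

/-- `𝔰` above the floor. [folklore] -/
theorem sK_of_le {y0 y : ℝ} (h : y0 ≤ y) : sK y0 y = y * Real.log y + y0 / 2 := if_pos h

/-- `𝔰` below the floor. [folklore] -/
theorem sK_of_lt {y0 y : ℝ} (h : y < y0) : sK y0 y = y * Real.log y0 + y ^ 2 / (2 * y0) := if_neg (not_le.2 h)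

/-- `𝔰(0) = 0` (`y₀ > 0`). [folklore] -/
theorem sK_zero {y0 : ℝ} (hy0 : 0 < y0) : sK y0 0 = 0 := by
  rw [sK_of_lt hy0]; simp

/-- Junction lemma: a function glued at `c` from two pieces with the same derivative at the point
and matching values at `c` is differentiable there. [folklore] -/
theorem hasDerivAt_ite_le {f₁ f₂ : ℝ → ℝ} {c y f' : ℝ}
    (h₁ : c ≤ y → HasDerivAt f₁ f' y) (h₂ : y ≤ c → HasDerivAt f₂ f' y) (hc : f₁ c = f₂ c) :
    HasDerivAt (fun t => if c ≤ t then f₁ t else f₂ t) f' y := by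
  rcases lt_trichotomy y c with hlt | rfl | hgt
  · refine (h₂ hlt.le).congr_of_eventuallyEq ?_
    filter_upwards [Iio_mem_nhds hlt] with t ht
    rw [if_neg (not_le.2 ht)]
  · have hl : HasDerivWithinAt (fun t => if y ≤ t then f₁ t else f₂ t) f' (Iic y) y := by
      refine (h₂ le_rfl).hasDerivWithinAt.congr (fun t ht => ?_) (by rw [if_pos le_rfl, hc])
      rcases eq_or_lt_of_le (show t ≤ y from ht) with rfl | hlt
      · rw [if_pos le_rfl, hc]
      · rw [if_neg (not_le.2 hlt)]
    have hr : HasDerivWithinAt (fun t => if y ≤ t then f₁ t else f₂ t) f' (Ici y) y :=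
      (h₁ le_rfl).hasDerivWithinAt.congr (fun t ht => if_pos ht) (if_pos le_rfl)
    have hu := hl.union hr
    rw [Iic_union_Ici] at hu
    exact hu.hasDerivAt Filter.univ_mem
  · refine (h₁ hgt.le).congr_of_eventuallyEq ?_
    filter_upwards [Ioi_mem_nhds hgt] with t ht
    rw [if_pos ht.le]

/-- `ℓ` is differentiable, with derivative `1/y` above the floor and `1/y₀` below. [folklore] -/
theorem hasDerivAt_flog {y0 : ℝ} (hy0 : 0 < y0) (y : ℝ) :
    HasDerivAt (flog y0) (if y0 ≤ y then y⁻¹ else y0⁻¹) y := by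
  unfold flog
  refine hasDerivAt_ite_le (fun h => ?_) (fun h => ?_) (by simp)
  · rw [if_pos h]
    exact Real.hasDerivAt_log (hy0.trans_le h).ne'
  · have hd : HasDerivAt (fun t => Real.log y0 + (t - y0) / y0) y0⁻¹ y := by
      have := (((hasDerivAt_id y).sub_const y0).div_const y0).const_add (Real.log y0)
      simpa [one_div] using this
    by_cases h' : y0 ≤ y
    · obtain rfl : y = y0 := le_antisymm h h'
      rw [if_pos le_rfl]
      exact hd
    · rw [if_neg h']
      exact hd

/-- `ℓ` is `y₀⁻¹`-Lipschitz on `ℝ`. [folklore] -/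
theorem abs_flog_sub_flog_le {y0 : ℝ} (hy0 : 0 < y0) (a b : ℝ) :
    |flog y0 a - flog y0 b| ≤ |a - b| / y0 := by
  have hb : ∀ x ∈ (univ : Set ℝ), ‖(if y0 ≤ x then x⁻¹ else y0⁻¹)‖ ≤ y0⁻¹ := by
    intro x _
    split_ifs with h
    · rw [Real.norm_eq_abs, abs_of_pos (inv_pos.2 (hy0.trans_le h))]
      exact inv_anti₀ hy0 h
    · rw [Real.norm_eq_abs, abs_of_pos (inv_pos.2 hy0)]
  have h := Convex.norm_image_sub_le_of_norm_hasDerivWithin_le (f := flog y0)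
    (fun x _ => (hasDerivAt_flog hy0 x).hasDerivWithinAt) hb convex_univ (mem_univ b) (mem_univ a)
  rw [Real.norm_eq_abs, Real.norm_eq_abs] at h
  rw [div_eq_inv_mul]
  exact h

/-- `𝔰' = 1 + ℓ` everywhere. [folklore] -/
theorem hasDerivAt_sK {y0 : ℝ} (hy0 : 0 < y0) (y : ℝ) : HasDerivAt (sK y0) (1 + flog y0 y) y := by
  unfold sK
  refine hasDerivAt_ite_le (fun h => ?_) (fun h => ?_) ?_
  · have hy : y ≠ 0 := (hy0.trans_le h).ne'
    have hd := (Real.hasDerivAt_mul_log hy).add_const (y0 / 2)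
    rw [flog_of_le h, add_comm]
    exact hd
  · have hd : HasDerivAt (fun t => t * Real.log y0 + t ^ 2 / (2 * y0))
        (1 * Real.log y0 + ↑2 * y ^ (2 - 1) / (2 * y0)) y :=
      ((hasDerivAt_id y).mul_const (Real.log y0)).add ((hasDerivAt_pow 2 y).div_const (2 * y0))
    refine hd.congr_deriv ?_
    rcases eq_or_lt_of_le h with rfl | hlt
    · rw [flog_of_le le_rfl]
      field_simp
      ring
    · rw [flog_of_lt hlt]
      field_simp
      ring
  · field_simp

/-- **First-order Taylor bound for `𝔰`**: `|𝔰(b) − 𝔰(a) − (1 + ℓ(a))(b − a)| ≤ (b − a)²/y₀`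
(the derivative `1 + ℓ` is `y₀⁻¹`-Lipschitz). [folklore] -/
theorem abs_sK_sub_sub_le {y0 : ℝ} (hy0 : 0 < y0) (a b : ℝ) :
    |sK y0 b - sK y0 a - (1 + flog y0 a) * (b - a)| ≤ (b - a) ^ 2 / y0 := by
  set ψ : ℝ → ℝ := fun t => sK y0 t - (1 + flog y0 a) * t with hψ
  have hd : ∀ t ∈ uIcc a b, HasDerivWithinAt ψ (flog y0 t - flog y0 a) (uIcc a b) t := fun t _ => by
    have h := (hasDerivAt_sK hy0 t).sub ((hasDerivAt_id t).const_mul (1 + flog y0 a))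
    refine (h.congr_deriv ?_).hasDerivWithinAt
    simp only [mul_one]
    ring
  have hb : ∀ t ∈ uIcc a b, ‖flog y0 t - flog y0 a‖ ≤ |b - a| / y0 := fun t ht => by
    rw [Real.norm_eq_abs]
    exact (abs_flog_sub_flog_le hy0 t a).trans
      (div_le_div_of_nonneg_right (abs_sub_left_of_mem_uIcc ht) hy0.le)
  have h := Convex.norm_image_sub_le_of_norm_hasDerivWithin_le hd hb (convex_uIcc a b) left_mem_uIcc
    right_mem_uIcc
  rw [Real.norm_eq_abs, Real.norm_eq_abs] at h
  have hψab : ψ b - ψ a = sK y0 b - sK y0 a - (1 + flog y0 a) * (b - a) := by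
    simp only [hψ]
    ring
  rw [← hψab]
  calc |ψ b - ψ a| ≤ |b - a| / y0 * |b - a| := h
    _ = (b - a) ^ 2 / y0 := by rw [div_mul_eq_mul_div, abs_mul_abs_self, sq]

/-- Sup bound for the floored logarithm on `[0, M]`: `|ℓ(y)| ≤ |log y₀| + |log M| + 1`. [folklore] -/
theorem abs_flog_le {y0 : ℝ} (hy0 : 0 < y0) {M y : ℝ} (hy : 0 ≤ y) (hyM : y ≤ M) :
    |flog y0 y| ≤ |Real.log y0| + |Real.log M| + 1 := by
  by_cases h : y0 ≤ y
  · rw [flog_of_le h]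
    have hyp : 0 < y := hy0.trans_le h
    have h1 : Real.log y0 ≤ Real.log y := Real.log_le_log hy0 h
    have h2 : Real.log y ≤ Real.log M := Real.log_le_log hyp hyM
    calc |Real.log y| ≤ max |Real.log y0| |Real.log M| := abs_le_max_abs_abs h1 h2
      _ ≤ |Real.log y0| + |Real.log M| := max_le_add_of_nonneg (abs_nonneg _) (abs_nonneg _)
      _ ≤ _ := by linarith
  · rw [flog_of_lt (not_le.1 h)]
    have h3 : |(y - y0) / y0| ≤ 1 := by
      rw [abs_div, abs_of_pos hy0, div_le_one hy0, abs_sub_comm, abs_of_nonneg (by linarith)]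
      linarith
    calc _ ≤ |Real.log y0| + |(y - y0) / y0| := abs_add_le _ _
      _ ≤ _ := by linarith [abs_nonneg (Real.log M)]

/-- `|1 + ℓ(y)| ≤ |log y₀| + |log M| + 2` on `[0, M]`. [folklore] -/
theorem abs_one_add_flog_le {y0 : ℝ} (hy0 : 0 < y0) {M y : ℝ} (hy : 0 ≤ y) (hyM : y ≤ M) :
    |1 + flog y0 y| ≤ |Real.log y0| + |Real.log M| + 2 := by
  have h := abs_flog_le hy0 hy hyM
  calc |1 + flog y0 y| ≤ |(1 : ℝ)| + |flog y0 y| := abs_add_le _ _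
    _ ≤ _ := by rw [abs_one]; linarith

/-- `𝔰` is Lipschitz on `[0, M]` with constant `|log y₀| + |log M| + 2`. [folklore] -/
theorem abs_sK_sub_sK_le {y0 : ℝ} (hy0 : 0 < y0) {M a b : ℝ} (ha : 0 ≤ a) (haM : a ≤ M) (hb : 0 ≤ b)
    (hbM : b ≤ M) : |sK y0 a - sK y0 b| ≤ (|Real.log y0| + |Real.log M| + 2) * |a - b| := by
  have hd : ∀ t ∈ Icc 0 M, HasDerivWithinAt (sK y0) (1 + flog y0 t) (Icc 0 M) t :=
    fun t _ => (hasDerivAt_sK hy0 t).hasDerivWithinAt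
  have hbd : ∀ t ∈ Icc 0 M, ‖1 + flog y0 t‖ ≤ |Real.log y0| + |Real.log M| + 2 :=
    fun t ht => by rw [Real.norm_eq_abs]; exact abs_one_add_flog_le hy0 ht.1 ht.2
  have h := Convex.norm_image_sub_le_of_norm_hasDerivWithin_le hd hbd (convex_Icc 0 M) ⟨hb, hbM⟩ ⟨ha, haM⟩
  rwa [Real.norm_eq_abs, Real.norm_eq_abs] at h

/-- `|𝔰(y)| ≤ (|log y₀| + |log M| + 2) y` on `[0, M]`. [folklore] -/
theorem abs_sK_le {y0 : ℝ} (hy0 : 0 < y0) {M y : ℝ} (hy : 0 ≤ y) (hyM : y ≤ M) :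
    |sK y0 y| ≤ (|Real.log y0| + |Real.log M| + 2) * y := by
  have h := abs_sK_sub_sK_le hy0 hy hyM le_rfl (hy.trans hyM)
  rwa [sK_zero hy0, sub_zero, sub_zero, abs_of_nonneg hy] at h

/-- `ℓ` is jointly measurable in `(y₀, y)`. [folklore] -/
theorem measurable_flog₂ : Measurable fun p : ℝ × ℝ => flog p.1 p.2 := by
  unfold flog
  refine Measurable.ite (measurableSet_le measurable_fst measurable_snd)
    (Real.measurable_log.comp measurable_snd) ?_
  exact (Real.measurable_log.comp measurable_fst).add ((measurable_snd.sub measurable_fst).div measurable_fst)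

/-- `𝔰` is jointly measurable in `(y₀, y)`. [folklore] -/
theorem measurable_sK₂ : Measurable fun p : ℝ × ℝ => sK p.1 p.2 := by
  unfold sK
  refine Measurable.ite (measurableSet_le measurable_fst measurable_snd)
    ((measurable_snd.mul (Real.measurable_log.comp measurable_snd)).add (measurable_fst.div_const 2)) ?_
  exact (measurable_snd.mul (Real.measurable_log.comp measurable_fst)).add
    ((measurable_snd.pow_const 2).div (measurable_fst.const_mul 2))

/-! ## §2 The velocity floor `y₀(v) = e^{−K}(1 + ‖v‖²)⁻²` and its logarithmic weight -/

variable {E : Type*} [NormedAddCommGroup E]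

/-- The floor level `y₀(v) = e^{−K} (1 + ‖v‖²)⁻²`. [folklore] -/
def yfl (K : ℝ) (v : E) : ℝ := Real.exp (-K) * ((1 + ‖v‖ ^ 2) ^ 2)⁻¹

/-- The logarithmic weight `A(v) = |K| + |log M| + 2 + 2 log(1 + ‖v‖²)`. [folklore] -/
def Aw (K M : ℝ) (v : E) : ℝ := |K| + |Real.log M| + 2 + 2 * Real.log (1 + ‖v‖ ^ 2)

omit [NormedAddCommGroup E] in
/-- `log(1 + x²) ≤ 2x` for `x ≥ 0`. [folklore] -/
theorem log_one_add_sq_le {x : ℝ} (hx : 0 ≤ x) : Real.log (1 + x ^ 2) ≤ 2 * x := by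
  have h1 : Real.log (1 + x ^ 2) ≤ Real.log ((1 + x) ^ 2) :=
    Real.log_le_log (by positivity) (by nlinarith)
  have h2 : Real.log ((1 + x) ^ 2) = 2 * Real.log (1 + x) := by
    rw [Real.log_pow]; push_cast; ring
  have h3 : Real.log (1 + x) ≤ x := by
    have := Real.log_le_sub_one_of_pos (show 0 < 1 + x by positivity)
    linarith
  linarith

/-- `y₀(v) > 0`. [folklore] -/
theorem yfl_pos (K : ℝ) (v : E) : 0 < yfl K v := by unfold yfl; positivity

/-- `y₀(v)⁻¹ = e^{K} (1 + ‖v‖²)²`. [folklore] -/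
theorem inv_yfl (K : ℝ) (v : E) : (yfl K v)⁻¹ = Real.exp K * (1 + ‖v‖ ^ 2) ^ 2 := by
  unfold yfl; rw [mul_inv, inv_inv, Real.exp_neg, inv_inv]

/-- `log y₀(v) = −K − 2 log(1 + ‖v‖²)`. [folklore] -/
theorem log_yfl (K : ℝ) (v : E) : Real.log (yfl K v) = -K - 2 * Real.log (1 + ‖v‖ ^ 2) := by
  unfold yfl
  rw [Real.log_mul (Real.exp_pos _).ne' (by positivity), Real.log_exp, Real.log_inv, Real.log_pow]
  push_cast
  ring

/-- `0 ≤ log(1 + ‖v‖²)`. [folklore] -/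
theorem log_one_add_norm_sq_nonneg (v : E) : 0 ≤ Real.log (1 + ‖v‖ ^ 2) :=
  Real.log_nonneg (by nlinarith [norm_nonneg v])

/-- `|log y₀(v)| ≤ |K| + 2 log(1 + ‖v‖²)`. [folklore] -/
theorem abs_log_yfl_le (K : ℝ) (v : E) : |Real.log (yfl K v)| ≤ |K| + 2 * Real.log (1 + ‖v‖ ^ 2) := by
  rw [log_yfl]
  have h := log_one_add_norm_sq_nonneg v
  calc |-K - 2 * Real.log (1 + ‖v‖ ^ 2)| ≤ |-K| + |2 * Real.log (1 + ‖v‖ ^ 2)| := abs_sub _ _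
    _ = |K| + 2 * Real.log (1 + ‖v‖ ^ 2) := by
        rw [abs_neg, abs_of_nonneg (mul_nonneg zero_le_two h)]

/-- The weight dominates the constants of §1 at the floor `y₀(v)`:
`|log y₀(v)| + |log M| + 2 ≤ A(v)`. [folklore] -/
theorem const_le_Aw (K M : ℝ) (v : E) : |Real.log (yfl K v)| + |Real.log M| + 2 ≤ Aw K M v := by
  have h := abs_log_yfl_le K v
  unfold Aw; linarith

/-- `2 ≤ A(v)`, in particular the weight is positive. [folklore] -/
theorem two_le_Aw (K M : ℝ) (v : E) : 2 ≤ Aw K M v := by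
  have h := log_one_add_norm_sq_nonneg v
  unfold Aw
  linarith [abs_nonneg K, abs_nonneg (Real.log M)]

/-- Linear growth of the weight: `A(v) ≤ |K| + |log M| + 2 + 4‖v‖`. [folklore] -/
theorem Aw_le (K M : ℝ) (v : E) : Aw K M v ≤ |K| + |Real.log M| + 2 + 4 * ‖v‖ := by
  have h := log_one_add_sq_le (norm_nonneg v)
  unfold Aw; linarith

/-- `|ℓ_{y₀(v)}(y)| ≤ A(v)` for `0 ≤ y ≤ M`. [folklore] -/
theorem abs_flog_yfl_le (K : ℝ) (v : E) {M y : ℝ} (hy : 0 ≤ y) (hyM : y ≤ M) :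
    |flog (yfl K v) y| ≤ Aw K M v := by
  have h1 := abs_flog_le (yfl_pos K v) hy hyM
  have h2 := const_le_Aw K M v
  linarith

/-- `|1 + ℓ_{y₀(v)}(y)| ≤ A(v)` for `0 ≤ y ≤ M`. [folklore] -/
theorem abs_one_add_flog_yfl_le (K : ℝ) (v : E) {M y : ℝ} (hy : 0 ≤ y) (hyM : y ≤ M) :
    |1 + flog (yfl K v) y| ≤ Aw K M v :=
  (abs_one_add_flog_le (yfl_pos K v) hy hyM).trans (const_le_Aw K M v)

/-- `|𝔰_{y₀(v)}(y)| ≤ A(v) y` for `0 ≤ y ≤ M`. [folklore] -/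
theorem abs_sK_yfl_le (K : ℝ) (v : E) {M y : ℝ} (hy : 0 ≤ y) (hyM : y ≤ M) :
    |sK (yfl K v) y| ≤ Aw K M v * y :=
  (abs_sK_le (yfl_pos K v) hy hyM).trans (mul_le_mul_of_nonneg_right (const_le_Aw K M v) hy)

/-- `|𝔰_{y₀(v)}(a) − 𝔰_{y₀(v)}(b)| ≤ A(v) |a − b|` for `a, b ∈ [0, M]`. [folklore] -/
theorem abs_sK_yfl_sub_le (K : ℝ) (v : E) {M a b : ℝ} (ha : 0 ≤ a) (haM : a ≤ M) (hb : 0 ≤ b)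
    (hbM : b ≤ M) : |sK (yfl K v) a - sK (yfl K v) b| ≤ Aw K M v * |a - b| :=
  (abs_sK_sub_sK_le (yfl_pos K v) ha haM hb hbM).trans
    (mul_le_mul_of_nonneg_right (const_le_Aw K M v) (abs_nonneg _))

/-- The floor is continuous in the velocity. [folklore] -/
theorem continuous_yfl (K : ℝ) : Continuous (yfl K : E → ℝ) := by
  unfold yfl
  refine continuous_const.mul (Continuous.inv₀ (by fun_prop) fun v => ?_)
  positivity

/-- The weight is continuous in the velocity. [folklore] -/
theorem continuous_Aw (K M : ℝ) : Continuous (Aw K M : E → ℝ) := by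
  unfold Aw
  refine continuous_const.add (continuous_const.mul (Continuous.log (by fun_prop) fun v => ?_))
  positivity

/-- REGISTERED SUB-GOAL `stub_windowedEntropyBalanceA` of the line `empirical-h-theorem` (crux
stmt-AtomisticToContinuum-15141): the elementary inequality `log(1 + x²) ≤ 2x` (`x ≥ 0`) behind the
linear growth of the entropic weight (restating `log_one_add_sq_le`). [folklore] -/
theorem stub_windowedEntropyBalanceA : ∀ x : ℝ, 0 ≤ x → Real.log (1 + x ^ 2) ≤ 2 * x :=
  fun _ hx => log_one_add_sq_le hx

end Summit.AtomisticToContinuum.HydrodynamicLimit.Theorems.ChaosClosesEulerEntropyBalance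

end
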